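import Mathlib
import Summits.KontsevichZagierPeriods.KontsevichZagierPeriods.Theorems.SoloInformedLogRoomUnbounded
import Summits.KontsevichZagierPeriods.KontsevichZagierPeriods.Theorems.SoloInformedFibreInterval
import HarnessLib

/-!
# Solo-informed (A390-ii): two-sided bounds for the normalised fibre power integral

File F4b of the KERNEL LEMMA I programme.  After Lion–Rolin preparation and normalisation the
mass of a fibre is `|a| · I` with `I = ∫_{(α₀, β)} s^r ds`, `0 ≤ α₀ < β ≤ ∞`.  This file bounds `I`
from both sides by SIMPLE monomials in the endpoint data — the `ℚ`-semialgebraic surrogates of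
the inductive step — on the geometric pieces

* NEAR `0 < α₀ < b ≤ 2α₀` (every `r`):           `I ≍ α₀^r (b − α₀)`;
* FAR, `r > -1`, `b > 2α₀` (`α₀ ≥ 0`):            `I ≍ b^r b`;
* FAR, `r < -1`, `0 < α₀`, `β ≥ 2α₀` or `β = ∞`:  `I ≍ α₀^r α₀`;
* FAR, `r = -1`, `0 < α₀ < b`:                    `1/2 ≤ I ≤ log (b/α₀)` (for `b ≥ 2α₀`);

and records the infinite cases (`α₀ = 0 ∧ r ≤ -1`, `β = ∞ ∧ r ≥ -1`).  Only monotonicity in the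
set, constant bounds for `s^r` on `[α₀, 2α₀]`, and the one-variable values of file 527 are used,
plus one FTC evaluation `∫_{α₀}^{b} ds/s = log (b/α₀)`.
-/

open MeasureTheory Set Real
open scoped ENNReal

namespace Summit.KontsevichZagierPeriods.KontsevichZagierPeriods.Theorems

/-! ### Elementary comparisons -/

/-- On `[α₀, 2α₀]` (`0 < α₀`): `2^{-|r|} α₀^r ≤ u^r ≤ 2^{|r|} α₀^r`. -/
theorem soloInformed_rpow_near_bounds {α₀ u : ℝ} (r : ℝ) (hα : 0 < α₀) (h1 : α₀ ≤ u)
    (h2 : u ≤ 2 * α₀) :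
    (2 : ℝ) ^ (-|r|) * α₀ ^ r ≤ u ^ r ∧ u ^ r ≤ (2 : ℝ) ^ |r| * α₀ ^ r := by
  have h2α : (2 * α₀) ^ r = (2 : ℝ) ^ r * α₀ ^ r := Real.mul_rpow (by norm_num) hα.le
  have hαr : 0 < α₀ ^ r := Real.rpow_pos_of_pos hα r
  have hlo := soloInformed_min_rpow_le r hα h1 h2
  have hhi := soloInformed_rpow_le_two_pow_mul_min r hα h1 h2
  have hmin_le : min (α₀ ^ r) ((2 * α₀) ^ r) ≤ α₀ ^ r := min_le_left _ _
  have hle_min : (2 : ℝ) ^ (-|r|) * α₀ ^ r ≤ min (α₀ ^ r) ((2 * α₀) ^ r) := by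
    have hA : (2 : ℝ) ^ (-|r|) ≤ 1 :=
      Real.rpow_le_one_of_one_le_of_nonpos (by norm_num) (neg_nonpos.mpr (abs_nonneg r))
    have hB : (2 : ℝ) ^ (-|r|) ≤ 2 ^ r :=
      Real.rpow_le_rpow_of_exponent_le (by norm_num) (neg_abs_le r)
    refine le_min ?_ ?_
    · calc (2 : ℝ) ^ (-|r|) * α₀ ^ r ≤ 1 * α₀ ^ r := mul_le_mul_of_nonneg_right hA hαr.le
        _ = α₀ ^ r := one_mul _
    · rw [h2α]
      exact mul_le_mul_of_nonneg_right hB hαr.le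
  exact ⟨hle_min.trans hlo, hhi.trans (mul_le_mul_of_nonneg_left hmin_le (by positivity))⟩

/-- `x^{r+1} = x^r · x` for `x ≠ 0` (restated direction of `Real.rpow_add_one`). -/
theorem soloInformed_rpow_add_one' {x : ℝ} (hx : x ≠ 0) (r : ℝ) : x ^ (r + 1) = x ^ r * x := by
  rw [Real.rpow_add_one hx, mul_comm]

/-! ### The normalised fibre integral `I(α₀, β) = ∫_{(α₀, β)} s^r ds` -/

/-- The extended interval `(α₀, β)` lies in `(α₀, ∞)`. -/
theorem soloInformed_EIoo_subset_Ioi (α₀ : ℝ) (β : EReal) :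
    soloInformedEIoo (α₀ : EReal) β ⊆ Ioi α₀ := fun _ hs =>
  EReal.coe_lt_coe_iff.mp ((soloInformed_mem_EIoo.mp hs).1)

/-- For `0 ≤ α₀`, the extended interval `(α₀, b)` lies in `(0, b)`. -/
theorem soloInformed_EIoo_subset_Ioo {α₀ : ℝ} (hα : 0 ≤ α₀) (b : ℝ) :
    soloInformedEIoo (α₀ : EReal) (b : EReal) ⊆ Ioo 0 b := fun s hs => by
  rw [soloInformed_EIoo_coe_coe] at hs
  exact ⟨hα.trans_lt hs.1, hs.2⟩

/-- A real interval `(α₀, m)` with `m ≤ β` lies in the extended interval `(α₀, β)`. -/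
theorem soloInformed_Ioo_subset_EIoo {α₀ m : ℝ} {β : EReal} (hm : (m : EReal) ≤ β) :
    Ioo α₀ m ⊆ soloInformedEIoo (α₀ : EReal) β := fun _ hs =>
  soloInformed_mem_EIoo.mpr ⟨EReal.coe_lt_coe_iff.mpr hs.1, (EReal.coe_lt_coe_iff.mpr hs.2).trans_le hm⟩

/-- **FAR, `r < -1`, upper**: `∫_{(α₀, β)} s^r ≤ α₀^r α₀ / (-(r+1))` for `0 < α₀`. -/
theorem soloInformed_Irp_neg_upper {r : ℝ} (hr : r < -1) {α₀ : ℝ} (hα : 0 < α₀) (β : EReal) :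
    ∫⁻ s in soloInformedEIoo (α₀ : EReal) β, ENNReal.ofReal (s ^ r) ≤
      ENNReal.ofReal (α₀ ^ r * α₀ / (-(r + 1))) := by
  calc ∫⁻ s in soloInformedEIoo (α₀ : EReal) β, ENNReal.ofReal (s ^ r)
      ≤ ∫⁻ s in Ioi α₀, ENNReal.ofReal (s ^ r) :=
        lintegral_mono_set (soloInformed_EIoo_subset_Ioi α₀ β)
    _ = ENNReal.ofReal (α₀ ^ (r + 1) / (-(r + 1))) := soloInformed_lintegral_rpow_Ioi hr hα
    _ = ENNReal.ofReal (α₀ ^ r * α₀ / (-(r + 1))) := by rw [soloInformed_rpow_add_one' hα.ne']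

/-- **Lower bound from the first octave**: for `r ≤ 0`, `0 < α₀` and `2α₀ ≤ β`,
`(2α₀)^r α₀ ≤ ∫_{(α₀, β)} s^r`. -/
theorem soloInformed_Irp_lower_octave {r : ℝ} (hr : r ≤ 0) {α₀ : ℝ} (hα : 0 < α₀) {β : EReal}
    (hβ : ((2 * α₀ : ℝ) : EReal) ≤ β) :
    ENNReal.ofReal ((2 * α₀) ^ r * α₀) ≤
      ∫⁻ s in soloInformedEIoo (α₀ : EReal) β, ENNReal.ofReal (s ^ r) := by
  have hvol : volume (Ioo α₀ (2 * α₀)) = ENNReal.ofReal α₀ := by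
    rw [Real.volume_Ioo]; congr 1; ring
  calc ENNReal.ofReal ((2 * α₀) ^ r * α₀)
      = ENNReal.ofReal ((2 * α₀) ^ r) * volume (Ioo α₀ (2 * α₀)) := by
        rw [hvol, ← ENNReal.ofReal_mul (Real.rpow_nonneg (by linarith) r)]
    _ ≤ ∫⁻ s in soloInformedEIoo (α₀ : EReal) β, ENNReal.ofReal (s ^ r) :=
        soloInformed_const_mul_volume_le_setLIntegral (soloInformed_Ioo_subset_EIoo hβ)
          measurableSet_Ioo fun u hu =>
            ENNReal.ofReal_le_ofReal (Real.rpow_le_rpow_of_nonpos (hα.trans hu.1) hu.2.le hr)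

/-- **FAR, `r < -1`, lower** in surrogate form: `2^r (α₀^r α₀) ≤ ∫_{(α₀, β)} s^r`
for `0 < α₀`, `2α₀ ≤ β`. -/
theorem soloInformed_Irp_neg_lower {r : ℝ} (hr : r < -1) {α₀ : ℝ} (hα : 0 < α₀) {β : EReal}
    (hβ : ((2 * α₀ : ℝ) : EReal) ≤ β) :
    ENNReal.ofReal ((2 : ℝ) ^ r * (α₀ ^ r * α₀)) ≤
      ∫⁻ s in soloInformedEIoo (α₀ : EReal) β, ENNReal.ofReal (s ^ r) := by
  have h := soloInformed_Irp_lower_octave (by linarith : r ≤ 0) hα hβ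
  rwa [Real.mul_rpow (by norm_num) hα.le, mul_assoc] at h

/-- **FAR, `r = -1`, lower**: `1/2 ≤ ∫_{(α₀, β)} s^{-1}` for `0 < α₀`, `2α₀ ≤ β`. -/
theorem soloInformed_Irp_inv_lower {α₀ : ℝ} (hα : 0 < α₀) {β : EReal}
    (hβ : ((2 * α₀ : ℝ) : EReal) ≤ β) :
    ENNReal.ofReal (1 / 2) ≤
      ∫⁻ s in soloInformedEIoo (α₀ : EReal) β, ENNReal.ofReal (s ^ (-1 : ℝ)) := by
  have h := soloInformed_Irp_lower_octave (by norm_num : (-1 : ℝ) ≤ 0) hα hβ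
  have hval : (2 * α₀) ^ (-1 : ℝ) * α₀ = 1 / 2 := by
    rw [Real.rpow_neg_one]; field_simp
  rwa [hval] at h

/-- **FAR, `r = -1`, upper**: `∫_{(α₀, b)} s^{-1} ≤ log (b/α₀)` for `0 < α₀ < b`
(fundamental theorem of calculus). -/
theorem soloInformed_Irp_inv_upper {α₀ b : ℝ} (hα : 0 < α₀) (hαb : α₀ < b) :
    ∫⁻ s in soloInformedEIoo (α₀ : EReal) (b : EReal), ENNReal.ofReal (s ^ (-1 : ℝ)) ≤
      ENNReal.ofReal (Real.log (b / α₀)) := by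
  rw [soloInformed_EIoo_coe_coe]
  have hb : 0 < b := hα.trans hαb
  have h0 : (0 : ℝ) ∉ uIcc α₀ b := by
    rw [uIcc_of_le hαb.le]; exact fun h => (lt_irrefl _) (hα.trans_le h.1)
  have hint : IntegrableOn (fun u : ℝ => u⁻¹) (Ioo α₀ b) :=
    ((intervalIntegral.intervalIntegrable_inv (a := α₀) (b := b)
      (fun x hx h => h0 (h ▸ hx)) continuousOn_id).1).mono_set Ioo_subset_Ioc_self
  have hnn : 0 ≤ᵐ[volume.restrict (Ioo α₀ b)] fun u : ℝ => u⁻¹ := by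
    filter_upwards [ae_restrict_mem measurableSet_Ioo] with u hu
    exact inv_nonneg.mpr (hα.le.trans hu.1.le)
  have hcongr : ∫⁻ s in Ioo α₀ b, ENNReal.ofReal (s ^ (-1 : ℝ)) =
      ∫⁻ s in Ioo α₀ b, ENNReal.ofReal s⁻¹ := by
    refine setLIntegral_congr_fun measurableSet_Ioo fun s _ => ?_
    rw [Real.rpow_neg_one]
  rw [hcongr, ← ofReal_integral_eq_lintegral_ofReal hint hnn, ← integral_Ioc_eq_integral_Ioo,
    ← intervalIntegral.integral_of_le hαb.le, integral_inv h0]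

/-- **NEAR bounds** (`0 < α₀`, `b ≤ 2α₀`, every `r`; both sides vanish unless `α₀ < b`):
`2^{-|r|} α₀^r (b − α₀) ≤ ∫_{(α₀, b)} s^r ≤ 2^{|r|} α₀^r (b − α₀)`. -/
theorem soloInformed_Irp_near_bounds (r : ℝ) {α₀ b : ℝ} (hα : 0 < α₀) (hb2 : b ≤ 2 * α₀) :
    ENNReal.ofReal ((2 : ℝ) ^ (-|r|) * α₀ ^ r * (b - α₀)) ≤
        ∫⁻ s in soloInformedEIoo (α₀ : EReal) (b : EReal), ENNReal.ofReal (s ^ r) ∧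
      ∫⁻ s in soloInformedEIoo (α₀ : EReal) (b : EReal), ENNReal.ofReal (s ^ r) ≤
        ENNReal.ofReal ((2 : ℝ) ^ |r| * α₀ ^ r * (b - α₀)) := by
  rw [soloInformed_EIoo_coe_coe]
  have hvol : volume (Ioo α₀ b) = ENNReal.ofReal (b - α₀) := Real.volume_Ioo
  have hlo : 0 ≤ (2 : ℝ) ^ (-|r|) * α₀ ^ r := by positivity
  have hhi : 0 ≤ (2 : ℝ) ^ |r| * α₀ ^ r := by positivity
  constructor
  · calc ENNReal.ofReal ((2 : ℝ) ^ (-|r|) * α₀ ^ r * (b - α₀))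
        = ENNReal.ofReal ((2 : ℝ) ^ (-|r|) * α₀ ^ r) * volume (Ioo α₀ b) := by
          rw [hvol, ← ENNReal.ofReal_mul hlo]
      _ ≤ ∫⁻ s in Ioo α₀ b, ENNReal.ofReal (s ^ r) :=
          soloInformed_const_mul_volume_le_setLIntegral subset_rfl measurableSet_Ioo fun u hu =>
            ENNReal.ofReal_le_ofReal
              (soloInformed_rpow_near_bounds r hα hu.1.le (hu.2.le.trans hb2)).1
  · calc ∫⁻ s in Ioo α₀ b, ENNReal.ofReal (s ^ r)
        ≤ ∫⁻ _ in Ioo α₀ b, ENNReal.ofReal ((2 : ℝ) ^ |r| * α₀ ^ r) :=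
          setLIntegral_mono' measurableSet_Ioo fun u hu =>
            ENNReal.ofReal_le_ofReal
              (soloInformed_rpow_near_bounds r hα hu.1.le (hu.2.le.trans hb2)).2
      _ = ENNReal.ofReal ((2 : ℝ) ^ |r| * α₀ ^ r * (b - α₀)) := by
          rw [setLIntegral_const, hvol, ← ENNReal.ofReal_mul hhi]

/-- **FAR, `r > -1`, upper**: `∫_{(α₀, b)} s^r ≤ b^r b / (r+1)` for `0 ≤ α₀`, `0 < b`. -/
theorem soloInformed_Irp_pos_upper {r : ℝ} (hr : -1 < r) {α₀ b : ℝ} (hα : 0 ≤ α₀) (hb : 0 < b) :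
    ∫⁻ s in soloInformedEIoo (α₀ : EReal) (b : EReal), ENNReal.ofReal (s ^ r) ≤
      ENNReal.ofReal (b ^ r * b / (r + 1)) := by
  calc ∫⁻ s in soloInformedEIoo (α₀ : EReal) (b : EReal), ENNReal.ofReal (s ^ r)
      ≤ ∫⁻ s in Ioo 0 b, ENNReal.ofReal (s ^ r) :=
        lintegral_mono_set (soloInformed_EIoo_subset_Ioo hα b)
    _ = ENNReal.ofReal (b ^ (r + 1) / (r + 1)) := soloInformed_lintegral_rpow_Ioo hr hb.le
    _ = ENNReal.ofReal (b ^ r * b / (r + 1)) := by rw [soloInformed_rpow_add_one' hb.ne']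

/-- **FAR, `r > -1`, lower** from the last octave `(b/2, b)`: for `2α₀ ≤ b`, `0 < b`,
`2^{-|r|} (2^{-r}/2) (b^r b) ≤ ∫_{(α₀, b)} s^r`. -/
theorem soloInformed_Irp_pos_lower (r : ℝ) {α₀ b : ℝ} (h2 : 2 * α₀ ≤ b) (hb : 0 < b) :
    ENNReal.ofReal ((2 : ℝ) ^ (-|r|) * ((2 : ℝ) ^ (-r) / 2) * (b ^ r * b)) ≤
      ∫⁻ s in soloInformedEIoo (α₀ : EReal) (b : EReal), ENNReal.ofReal (s ^ r) := by
  have hb2 : 0 < b / 2 := by linarith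
  have hsub : Ioo (b / 2) b ⊆ soloInformedEIoo (α₀ : EReal) (b : EReal) := by
    intro s hs
    rw [soloInformed_EIoo_coe_coe]
    exact ⟨by linarith [hs.1], hs.2⟩
  have hvol : volume (Ioo (b / 2) b) = ENNReal.ofReal (b / 2) := by
    rw [Real.volume_Ioo]; congr 1; ring
  have hhalf : (b / 2) ^ r = (2 : ℝ) ^ (-r) * b ^ r := by
    rw [div_eq_mul_inv, Real.mul_rpow hb.le (by norm_num), Real.inv_rpow (by norm_num),
      ← Real.rpow_neg (by norm_num), mul_comm]
  have hval : (2 : ℝ) ^ (-|r|) * ((2 : ℝ) ^ (-r) / 2) * (b ^ r * b) =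
      (2 : ℝ) ^ (-|r|) * (b / 2) ^ r * (b / 2) := by
    rw [hhalf]; ring
  have hc : 0 ≤ (2 : ℝ) ^ (-|r|) * (b / 2) ^ r := by positivity
  rw [hval]
  calc ENNReal.ofReal ((2 : ℝ) ^ (-|r|) * (b / 2) ^ r * (b / 2))
      = ENNReal.ofReal ((2 : ℝ) ^ (-|r|) * (b / 2) ^ r) * volume (Ioo (b / 2) b) := by
        rw [hvol, ← ENNReal.ofReal_mul hc]
    _ ≤ ∫⁻ s in soloInformedEIoo (α₀ : EReal) (b : EReal), ENNReal.ofReal (s ^ r) :=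
        soloInformed_const_mul_volume_le_setLIntegral hsub measurableSet_Ioo fun u hu =>
          ENNReal.ofReal_le_ofReal
            (soloInformed_rpow_near_bounds r hb2 hu.1.le (by linarith [hu.2])).1

/-! ### The infinite cases -/

/-- `β = ∞`, `r ≥ -1`, `α₀ ≥ 0`: the fibre power integral is infinite. -/
theorem soloInformed_Irp_top_eq_top_of_le {r : ℝ} (hr : -1 ≤ r) {α₀ : ℝ} (hα : 0 ≤ α₀) :
    ∫⁻ s in soloInformedEIoo (α₀ : EReal) ⊤, ENNReal.ofReal (s ^ r) = ⊤ := by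
  rw [soloInformed_EIoo_coe_top]
  exact soloInformed_lintegral_rpow_Ioi_eq_top hr hα

/-- `β = ∞`, `α₀ = 0`: the fibre power integral is infinite for every `r`. -/
theorem soloInformed_Irp_zero_top_eq_top (r : ℝ) :
    ∫⁻ s in soloInformedEIoo ((0 : ℝ) : EReal) ⊤, ENNReal.ofReal (s ^ r) = ⊤ := by
  rw [soloInformed_EIoo_coe_top]
  exact soloInformed_lintegral_rpow_Ioi_zero_eq_top r

/-- `α₀ = 0`, `r ≤ -1`, `b > 0`: the fibre power integral is infinite. -/
theorem soloInformed_Irp_zero_coe_eq_top {r : ℝ} (hr : r ≤ -1) {b : ℝ} (hb : 0 < b) :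
    ∫⁻ s in soloInformedEIoo ((0 : ℝ) : EReal) (b : EReal), ENNReal.ofReal (s ^ r) = ⊤ := by
  rw [soloInformed_EIoo_coe_coe]
  exact soloInformed_lintegral_rpow_Ioo_eq_top hr hb

/-- `α₀ = 0`, `r ≤ -1`, any `β > 0`: the fibre power integral is infinite. -/
theorem soloInformed_Irp_zero_eq_top {r : ℝ} (hr : r ≤ -1) {β : EReal} (hβ : (0 : EReal) < β) :
    ∫⁻ s in soloInformedEIoo ((0 : ℝ) : EReal) β, ENNReal.ofReal (s ^ r) = ⊤ := by
  induction β using EReal.rec with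
  | bot => exact absurd hβ (not_lt.mpr bot_le)
  | coe b =>
      have hb : 0 < b := by exact_mod_cast hβ
      exact soloInformed_Irp_zero_coe_eq_top hr hb
  | top => exact soloInformed_Irp_zero_top_eq_top r

end Summit.KontsevichZagierPeriods.KontsevichZagierPeriods.Theorems
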